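/-
Copyright (c) 2026 the pub-hodgecm-mathlib formalisation cell (harness21).  Prover seat hodgecm-mathlib-K2E3-p23 (g2): Track B «K2-LIT», engine E3, line (ii′)
«H-side central germ expansion» (line lead K2E4-p06 (g2)), leaf (E) `sig_K2E3CentralGermExpansionExistence` — the ASSEMBLY modulo (RAO_z) and (DUAL_z); 2026-09-04.
-/
import Literature.NumberTheory.Rogawski1990.TamagawaSingularMembersFinTFCovol   -- ★ frame vocabulary of the U3b prefix (`IsLocalTransferDatum`, `LocalTransferFactor`, `IsCanonical`, …)
import Literature.NumberTheory.Weil1982.UnitaryFinCentralizerTopFormHaar         -- ★ (U3b prefix import, kept so the socket statement elaborates identically)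
import Literature.NumberTheory.Rogawski1990.FinExplicitTransferFactorConjLeft     -- ★ (idem)
import Literature.NumberTheory.Rogawski1990.FinExplicitTransferFactorConjRight    -- ★ (idem)
import Literature.NumberTheory.Rogawski1990.ArchCanonicalTransferFactor           -- ★ (idem)
import Literature.NumberTheory.Rogawski1990.ExplicitFactorProductFormula          -- ★ (idem) `UnitaryGroup.PlacesOver`
import Literature.NumberTheory.Automorphic.QuadraticHeckeCharacterCM              -- ★ (idem)
import Literature.NumberTheory.Rogawski1990.UnitaryTwoOneCentralFarSupportCM      -- ★∕pending (E5) FAR_z (this seat): `exists_nhds_forall_isLocalStablyConjH_conj_apply_eq_zero`; brings (E2b) ★ p855879 `exists_enum_centralUnipotent_isClosed_iUnion_lt`, `centralUnipotent_conj_iff`, `centralUnipotent_self`, (E1) ★ p855739 `unitaryTwoOne_central_unipotent_conjClasses_finite`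
import Literature.MeasureTheory.Group.OrbitalIntegralKernelDecomposition           -- ★ SPAN `exists_add_mem_span_conj_sub_of_classOrbitalIntegral_eq_zero` (Howe, generic)
import Literature.NumberTheory.Rogawski1990.ShalikaGermExpansionInvariantKernel   -- ★ SH-2 `classOrbitalIntegral_eq_zero_of_mem_span_conj_sub`, `isLocSmooth_of_mem_span_conj_sub`
import Literature.NumberTheory.Automorphic.OrbitalIntegralFinitePieces            -- ★ `classOrbitalIntegral_finset_sum`
import Literature.NumberTheory.Automorphic.LocalEndoscopicOrbitClosed             -- ★ H-side: `integrable_descConj_localH_of_isLocalGRegular`, `localStableOrbitalIntegralH_add_of_isLocalGRegular`, `…_smul_fun`, `isGRegular_of_isStablyConjH`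
import Literature.NumberTheory.Automorphic.OrbitalMeasureCanonical                -- ★ `OrbitalMeasureFamily.IsCanonical.isAdmissibleOn`
import Literature.NumberTheory.Automorphic.OrbitalMeasureCentralMass              -- ★ `quotientOut_conjClassesMk_eq_of_forall_comm`
import Literature.NumberTheory.Rogawski1990.LocalTransferGlueCM                   -- ★ `totallyDisconnectedSpace_cmDatum_local`
import Literature.NumberTheory.Rogawski1990.LocalTransferGlue                     -- ★ `IsLocSmooth.add`, `IsLocSmooth.finset_sum`
import Summits.HodgeConjecture.HodgeConjecture.Theorems.K2E4ExplicitSplitConstantPhasePair   -- ★ (K2E4-p02): `isHaarMeasure_of_ne_zero`, `stableOrbitalIntegralRel_eq_zero_of_measure_eq_zero` (the `νHv = 0` branch)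
import HarnessLib

/-!
# (E) `sig_K2E3CentralGermExpansionExistence` MODULO (RAO_z) AND (DUAL_z): the STABLE, CENTRED Shalika germ expansion on `H_v = U(Φ₂)(L⁺_v) × U(Φ₁)(L⁺_v)`
# from Ranga Rao's clause and the dual pieces at the classes over `z` (Rogawski 1990 §8.1 Prop. 8.1.1, Howe ∕ Gelfand–Kazhdan — rank one × abelian, centred)

Topic: cell `pub/hodgecm-mathlib` (D-0151), crux H413 = `stmt-HodgeConjecture-24833`; Track B «K2-LIT», engine E3 `K2_E3_EllipticInputs`, tier-1 unit `…Sigs_U3bCentralGerms`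
(ED. 3∕4), line (ii′) «H-side central germ expansion with independent tails» (line lead K2E4-p06 (g2)), leaf **(E) `sig_K2E3CentralGermExpansionExistence`** (cand
aea6e516723791cf, hosted VERBATIM).  Namespace `Summit.HodgeConjecture.HodgeConjecture.Cruxes.H413.K2E3CentralGermExpansionExistenceOfRao`.  THEOREMS ONLY (no definition, no
instance, no notation, no `sorry`); kernel lane `--supports stmt-HodgeConjecture-24833 --as helper`.  Seat K2E3-p23 (g2), brick (E5′) of the programme (E1) ★ p855739 ‹U-FIN₂› ·
(E2) ★ p855772 ∕ p855844 ∕ p855879 «STRATA₂» · (E3) ‹RAO_z› · (E4) ‹DUAL_z› (K2E4-p21 (g2)) · (E5) FAR_z + THIS ASSEMBLY.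
HONEST LABEL: HC_CM is proved only modulo the 7 printed citations (2 remaining named inputs: hLiu418 = stmt-HodgeConjecture-24832, h413 = stmt-HodgeConjecture-24833) until rung 0
closes.  This file is an IMPLICATION: (E) becomes REL over the two leaves (RAO_z) `sig_K2E3CentralUnipotentOrbitalMeasures` (cand 8d919bc037b0f39d, payer: brick (E3)) and
(DUAL_z) `sig_K2E3CentralUnipotentDualPieces` (cand f5db471200e2a663, payer: K2E4-p21 (g2)), both taken here as HYPOTHESES with their bytes pasted (never `import Cruxes/…/Lines`).

THE PROOF ([Rogawski1990] p. 113, Howe's argument, run at a central `z` on the STABLE H-integral).  Fix `z ∈ Z(H_v)`.  `S` := THE finite set of classes over `z`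
(★ (E1) `unitaryTwoOne_central_unipotent_conjClasses_finite`; `⟦z⟧ ∈ S` since `out ⟦z⟧ = z`, ★ `quotientOut_conjClassesMk_eq_of_forall_comm`); `mU` := (RAO_z); dual pieces
`fd u` := (DUAL_z); SPAN := ★ `exists_add_mem_span_conj_sub_of_classOrbitalIntegral_eq_zero` over the closed enumeration ★ (E2b) `exists_enum_centralUnipotent_isClosed_iUnion_lt`
(«over z» is a class function, ★ `centralUnipotent_conj_iff`).  GERMS: `Γ_u(γ) := Φ^{st}_H(γ, fd u)`.  For `fH ∈ C_c^∞(H_v)` put `P := Σ_{u∈S} Φ_{mU}(u, fH)·fd u` and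
`F := fH − P`; then `Φ_{mU}(u′, F) = 0` on `S` (duality), so `F = F₀ + F₁` with `F₀ ∈ C₀ = span{φ^x − φ}` and `tsupport F₁` off the stratum over `z`.  At a `G`-regular `γ`:
`Φ^{st}(γ, fH) = Σ_u Φ_{mU}(u, fH)·Γ_u(γ) + Φ^{st}(γ, F₀) + Φ^{st}(γ, F₁)` (★ `localStableOrbitalIntegralH_add_of_isLocalGRegular` ∕ `…_smul_fun`, the canonical `mHv` being
admissible once `νHv ≠ 0` is Haar, ★ `isHaarMeasure_of_ne_zero`; if `νHv = 0` both sides vanish, ★ `stableOrbitalIntegralRel_eq_zero_of_measure_eq_zero`); `Φ^{st}(γ, F₀) = 0`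
class by class (★ SH-2 `classOrbitalIntegral_eq_zero_of_mem_span_conj_sub`, the `G`-regular orbital integrands being integrable, ★ `integrable_descConj_localH_of_isLocalGRegular`);
and `Φ^{st}(γ, F₁) = 0` for `γ` in the FAR_z neighbourhood of `z` (★ `exists_nhds_forall_isLocalStablyConjH_conj_apply_eq_zero`: every orbital integrand of `F₁` over a class of
the stable class of `γ` vanishes identically) — which is a neighbourhood in the elliptic `G`-regular filter `𝓝[{G-regular ∧ compact centraliser}] z` a fortiori.

* `stableOrbitalIntegralRel_finset_sum_smul_of_isLocalGRegular` (`Φ^{st}_H(γ, Σ_u a_u·φ_u) = Σ_u a_u·Φ^{st}_H(γ, φ_u)` on `C_c^∞`, `G`-regular `γ`, admissible family);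
* **`centralGermExpansionExistence_of_rao_of_dual : ‹(RAO_z)› → ‹(DUAL_z)› → ‹(E) sig_K2E3CentralGermExpansionExistence›`** (statements pasted verbatim).

## References
* [Rogawski1990] J. D. Rogawski, *Automorphic Representations of Unitary Groups in Three Variables*, Ann. of Math. Stud. 123 (1990): §8.1 Prop. 8.1.1 pp. 112–113 (germ expansion,
  Howe ∕ Gelfand–Kazhdan proof); Prop. 8.1.2 (a) p. 114 (descent to the centraliser); §4.3 (4.3.1) p. 43 (stable orbital integrals on `H`); §4.9 p. 54.
* [Howe1974] R. Howe, *The Fourier transform and germs of characters (case of Gl_n over a p-adic field)*, Math. Ann. 208 (1974) 305–322, Prop. 2.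
* [Rao1972] R. Ranga Rao, *Orbital integrals in reductive groups*, Ann. of Math. (2) 96 (1972) 505–510.
* [HarishChandra1999AdmissibleDistributions] Harish-Chandra (DeBacker–Sally), *Admissible Invariant Distributions on Reductive p-adic Groups*, AMS ULS 16 (1999), Thm. 8.1 p. 48.
-/

set_option autoImplicit false
set_option linter.dupNamespace false

noncomputable section

open Filter Topology Set
open MeasureTheory Measure NumberField IsDedekindDomain
open Literature.MeasureTheory.Group Literature.MeasureTheory.RestrictedProduct
open Literature.Topology.RestrictedProduct Literature.Topology.Algebra.RestrictedProduct
open Literature.NumberTheory.Rogawski1990 Literature.NumberTheory.Automorphic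
open Literature.AlgebraicGeometry.ShimuraVarieties (unitaryGroup hermForm)
open Summit.HodgeConjecture.HodgeConjecture.Cruxes.H413.K2E4ExplicitSplitConstantPhase (isHaarMeasure_of_ne_zero stableOrbitalIntegralRel_eq_zero_of_measure_eq_zero)
open scoped Matrix MatrixGroups RestrictedProduct

namespace Summit.HodgeConjecture.HodgeConjecture.Cruxes.H413.K2E3CentralGermExpansionExistenceOfRao

/-! ## §1 The H-side stable integral of a finite combination of `C_c^∞` functions at a `G`-regular point -/

section StableSum

variable (L : Type) [Field L] [NumberField L] [IsCMField L] (v : HeightOneSpectrum (𝓞 ↥(maximalRealSubfield L)))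
  [MeasurableSpace ((UnitaryGroup.cmDatum L 2 (Matrix.of fun i j : Fin 2 => if i.val + j.val + 1 = 2 then (1 : L) else 0)).Local v × (UnitaryGroup.cmDatum L 1 (Matrix.of fun i j : Fin 1 => if i.val + j.val + 1 = 1 then (1 : L) else 0)).Local v)] [BorelSpace ((UnitaryGroup.cmDatum L 2 (Matrix.of fun i j : Fin 2 => if i.val + j.val + 1 = 2 then (1 : L) else 0)).Local v × (UnitaryGroup.cmDatum L 1 (Matrix.of fun i j : Fin 1 => if i.val + j.val + 1 = 1 then (1 : L) else 0)).Local v)]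
  [∀ a : (UnitaryGroup.cmDatum L 2 (Matrix.of fun i j : Fin 2 => if i.val + j.val + 1 = 2 then (1 : L) else 0)).Local v × (UnitaryGroup.cmDatum L 1 (Matrix.of fun i j : Fin 1 => if i.val + j.val + 1 = 1 then (1 : L) else 0)).Local v, MeasurableSpace (((UnitaryGroup.cmDatum L 2 (Matrix.of fun i j : Fin 2 => if i.val + j.val + 1 = 2 then (1 : L) else 0)).Local v × (UnitaryGroup.cmDatum L 1 (Matrix.of fun i j : Fin 1 => if i.val + j.val + 1 = 1 then (1 : L) else 0)).Local v) ⧸ Subgroup.centralizer ({a} : Set ((UnitaryGroup.cmDatum L 2 (Matrix.of fun i j : Fin 2 => if i.val + j.val + 1 = 2 then (1 : L) else 0)).Local v × (UnitaryGroup.cmDatum L 1 (Matrix.of fun i j : Fin 1 => if i.val + j.val + 1 = 1 then (1 : L) else 0)).Local v)))]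
  [∀ a : (UnitaryGroup.cmDatum L 2 (Matrix.of fun i j : Fin 2 => if i.val + j.val + 1 = 2 then (1 : L) else 0)).Local v × (UnitaryGroup.cmDatum L 1 (Matrix.of fun i j : Fin 1 => if i.val + j.val + 1 = 1 then (1 : L) else 0)).Local v, BorelSpace (((UnitaryGroup.cmDatum L 2 (Matrix.of fun i j : Fin 2 => if i.val + j.val + 1 = 2 then (1 : L) else 0)).Local v × (UnitaryGroup.cmDatum L 1 (Matrix.of fun i j : Fin 1 => if i.val + j.val + 1 = 1 then (1 : L) else 0)).Local v) ⧸ Subgroup.centralizer ({a} : Set ((UnitaryGroup.cmDatum L 2 (Matrix.of fun i j : Fin 2 => if i.val + j.val + 1 = 2 then (1 : L) else 0)).Local v × (UnitaryGroup.cmDatum L 1 (Matrix.of fun i j : Fin 1 => if i.val + j.val + 1 = 1 then (1 : L) else 0)).Local v)))]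

omit [MeasurableSpace ((UnitaryGroup.cmDatum L 2 (Matrix.of fun i j : Fin 2 => if i.val + j.val + 1 = 2 then (1 : L) else 0)).Local v × (UnitaryGroup.cmDatum L 1 (Matrix.of fun i j : Fin 1 => if i.val + j.val + 1 = 1 then (1 : L) else 0)).Local v)] [BorelSpace ((UnitaryGroup.cmDatum L 2 (Matrix.of fun i j : Fin 2 => if i.val + j.val + 1 = 2 then (1 : L) else 0)).Local v × (UnitaryGroup.cmDatum L 1 (Matrix.of fun i j : Fin 1 => if i.val + j.val + 1 = 1 then (1 : L) else 0)).Local v)] in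
/-- **`Φ^{st}_H(γ, Σ_{u ∈ s} a_u·φ_u) = Σ_{u ∈ s} a_u·Φ^{st}_H(γ, φ_u)`** for `φ_u ∈ C_c^∞(H_v)`, `γ` `G`-regular and a family admissible on the `G`-regular classes
(induction over `s` with ★ `localStableOrbitalIntegralH_add_of_isLocalGRegular` and ★ `localStableOrbitalIntegralH_smul_fun`). [cite: Rogawski1990, §4.3 (4.3.1) p. 43] -/
theorem stableOrbitalIntegralRel_finset_sum_smul_of_isLocalGRegular
    {m : OrbitalMeasureFamily ((UnitaryGroup.cmDatum L 2 (Matrix.of fun i j : Fin 2 => if i.val + j.val + 1 = 2 then (1 : L) else 0)).Local v × (UnitaryGroup.cmDatum L 1 (Matrix.of fun i j : Fin 1 => if i.val + j.val + 1 = 1 then (1 : L) else 0)).Local v)} (hm : m.IsAdmissibleOn (IsLocalGRegular L v))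
    {γ : (UnitaryGroup.cmDatum L 2 (Matrix.of fun i j : Fin 2 => if i.val + j.val + 1 = 2 then (1 : L) else 0)).Local v × (UnitaryGroup.cmDatum L 1 (Matrix.of fun i j : Fin 1 => if i.val + j.val + 1 = 1 then (1 : L) else 0)).Local v} (hγ : IsLocalGRegular L v γ)
    {ι : Type*} (s : Finset ι) (a : ι → ℂ) (φ : ι → (UnitaryGroup.cmDatum L 2 (Matrix.of fun i j : Fin 2 => if i.val + j.val + 1 = 2 then (1 : L) else 0)).Local v × (UnitaryGroup.cmDatum L 1 (Matrix.of fun i j : Fin 1 => if i.val + j.val + 1 = 1 then (1 : L) else 0)).Local v → ℂ) (hφ : ∀ i ∈ s, IsLocSmooth (φ i)) :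
    stableOrbitalIntegralRel (IsLocalStablyConjH L v) m (∑ i ∈ s, a i • φ i) γ = ∑ i ∈ s, a i * stableOrbitalIntegralRel (IsLocalStablyConjH L v) m (φ i) γ := by
  classical
  have hsm : ∀ (c : ℂ) {ψ : (UnitaryGroup.cmDatum L 2 (Matrix.of fun i j : Fin 2 => if i.val + j.val + 1 = 2 then (1 : L) else 0)).Local v × (UnitaryGroup.cmDatum L 1 (Matrix.of fun i j : Fin 1 => if i.val + j.val + 1 = 1 then (1 : L) else 0)).Local v → ℂ}, IsLocSmooth ψ → IsLocSmooth (c • ψ) := fun c ψ hψ =>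
    ⟨hψ.1.comp fun t => c * t, hψ.2.mono (Function.support_const_smul_subset c ψ)⟩
  induction s using Finset.induction_on with
  | empty =>
    rw [Finset.sum_empty, Finset.sum_empty]
    exact stableOrbitalIntegralRel_zero _ m γ
  | insert i s hi ih =>
    have hφs : ∀ j ∈ s, IsLocSmooth (φ j) := fun j hj => hφ j (Finset.mem_insert_of_mem hj)
    have hsum : IsLocSmooth (∑ j ∈ s, a j • φ j) := IsLocSmooth.finset_sum s fun j hj => hsm _ (hφs j hj)
    have hai : IsLocSmooth (a i • φ i) := hsm _ (hφ i (Finset.mem_insert_self i s))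
    rw [Finset.sum_insert hi, Finset.sum_insert hi,
      UnitaryGroup.localStableOrbitalIntegralH_add_of_isLocalGRegular L v γ hγ (hm := hm) hai.1.continuous hai.2 hsum.1.continuous hsum.2,
      UnitaryGroup.localStableOrbitalIntegralH_smul_fun L v m (a i) (φ i) γ, ih hφs]

end StableSum

/-! ## §2 (E) modulo (RAO_z) and (DUAL_z) -/

set_option maxHeartbeats 3200000 in
-- statement-heavy: three socket statements on the product carrier; the proof itself is assembly
/-- **(E) `sig_K2E3CentralGermExpansionExistence` ⟸ (RAO_z) + (DUAL_z).**  Hypotheses = the hosted∕cand sockets `sig_K2E3CentralUnipotentOrbitalMeasures` (Ranga Rao at the classes over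
a central `z`: admissible family + integrability) and `sig_K2E3CentralUnipotentDualPieces` (dual pieces), VERBATIM; conclusion = (E) VERBATIM: for central `z` there are finitely
many classes `S ∋ ⟦z⟧` over `z`, the (RAO_z) family `mU`, and GERMS `Γ_u := Φ^{st}_H(·, fd u)` (the stable H-integrals of the dual pieces) with
`Φ^{st}_H(γ, fH) = Σ_{u∈S} Φ_{mU}(u, fH)·Γ_u(γ)` eventually along `𝓝[ell ∧ G-reg] z`, for every `fH ∈ C_c^∞(H_v)`.  Howe's argument at `z`: `fH − Σ_u Φ_{mU}(u, fH)·fd u = F₀ + F₁`,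
`F₀ ∈ C₀` killed class by class (★ SH-2 at `G`-regular classes), `F₁` far from the stratum over `z` killed near `z` on whole stable classes (★ FAR_z); stable additivity ★; the degenerate
`νHv = 0` frame gives `0 = 0` (★ `stableOrbitalIntegralRel_eq_zero_of_measure_eq_zero`). [cite: Rogawski1990, §8.1 Prop. 8.1.1 pp. 112–113; §4.3 (4.3.1) p. 43]
[cite: Howe1974, Prop. 2] [cite: Rao1972, Theorem] [cite: HarishChandra1999AdmissibleDistributions, Thm. 8.1 p. 48] -/
theorem centralGermExpansionExistence_of_rao_of_dual
    (hrao :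
      ∀ (L : Type) [Field L] [NumberField L] [IsCMField L] (v : HeightOneSpectrum (𝓞 ↥(maximalRealSubfield L)))
      [MeasurableSpace ((UnitaryGroup.cmDatum L 2 (Matrix.of fun i j : Fin 2 => if i.val + j.val + 1 = 2 then (1 : L) else 0)).Local v × (UnitaryGroup.cmDatum L 1 (Matrix.of fun i j : Fin 1 => if i.val + j.val + 1 = 1 then (1 : L) else 0)).Local v)] [BorelSpace ((UnitaryGroup.cmDatum L 2 (Matrix.of fun i j : Fin 2 => if i.val + j.val + 1 = 2 then (1 : L) else 0)).Local v × (UnitaryGroup.cmDatum L 1 (Matrix.of fun i j : Fin 1 => if i.val + j.val + 1 = 1 then (1 : L) else 0)).Local v)]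
      [∀ a : (UnitaryGroup.cmDatum L 2 (Matrix.of fun i j : Fin 2 => if i.val + j.val + 1 = 2 then (1 : L) else 0)).Local v × (UnitaryGroup.cmDatum L 1 (Matrix.of fun i j : Fin 1 => if i.val + j.val + 1 = 1 then (1 : L) else 0)).Local v,
      MeasurableSpace (((UnitaryGroup.cmDatum L 2 (Matrix.of fun i j : Fin 2 => if i.val + j.val + 1 = 2 then (1 : L) else 0)).Local v × (UnitaryGroup.cmDatum L 1 (Matrix.of fun i j : Fin 1 => if i.val + j.val + 1 = 1 then (1 : L) else 0)).Local v) ⧸ Subgroup.centralizer ({a} : Set ((UnitaryGroup.cmDatum L 2 (Matrix.of fun i j : Fin 2 => if i.val + j.val + 1 = 2 then (1 : L) else 0)).Local v × (UnitaryGroup.cmDatum L 1 (Matrix.of fun i j : Fin 1 => if i.val + j.val + 1 = 1 then (1 : L) else 0)).Local v)))]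
      [∀ a : (UnitaryGroup.cmDatum L 2 (Matrix.of fun i j : Fin 2 => if i.val + j.val + 1 = 2 then (1 : L) else 0)).Local v × (UnitaryGroup.cmDatum L 1 (Matrix.of fun i j : Fin 1 => if i.val + j.val + 1 = 1 then (1 : L) else 0)).Local v,
      BorelSpace (((UnitaryGroup.cmDatum L 2 (Matrix.of fun i j : Fin 2 => if i.val + j.val + 1 = 2 then (1 : L) else 0)).Local v × (UnitaryGroup.cmDatum L 1 (Matrix.of fun i j : Fin 1 => if i.val + j.val + 1 = 1 then (1 : L) else 0)).Local v) ⧸ Subgroup.centralizer ({a} : Set ((UnitaryGroup.cmDatum L 2 (Matrix.of fun i j : Fin 2 => if i.val + j.val + 1 = 2 then (1 : L) else 0)).Local v × (UnitaryGroup.cmDatum L 1 (Matrix.of fun i j : Fin 1 => if i.val + j.val + 1 = 1 then (1 : L) else 0)).Local v)))],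
      Subsingleton (UnitaryGroup.PlacesOver L v) →
      ∀ z : (UnitaryGroup.cmDatum L 2 (Matrix.of fun i j : Fin 2 => if i.val + j.val + 1 = 2 then (1 : L) else 0)).Local v × (UnitaryGroup.cmDatum L 1 (Matrix.of fun i j : Fin 1 => if i.val + j.val + 1 = 1 then (1 : L) else 0)).Local v, z ∈ Subgroup.center ((UnitaryGroup.cmDatum L 2 (Matrix.of fun i j : Fin 2 => if i.val + j.val + 1 = 2 then (1 : L) else 0)).Local v × (UnitaryGroup.cmDatum L 1 (Matrix.of fun i j : Fin 1 => if i.val + j.val + 1 = 1 then (1 : L) else 0)).Local v) →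
      ∃ mU : OrbitalMeasureFamily ((UnitaryGroup.cmDatum L 2 (Matrix.of fun i j : Fin 2 => if i.val + j.val + 1 = 2 then (1 : L) else 0)).Local v × (UnitaryGroup.cmDatum L 1 (Matrix.of fun i j : Fin 1 => if i.val + j.val + 1 = 1 then (1 : L) else 0)).Local v),
      mU.IsAdmissibleOn (fun γ : (UnitaryGroup.cmDatum L 2 (Matrix.of fun i j : Fin 2 => if i.val + j.val + 1 = 2 then (1 : L) else 0)).Local v × (UnitaryGroup.cmDatum L 1 (Matrix.of fun i j : Fin 1 => if i.val + j.val + 1 = 1 then (1 : L) else 0)).Local v =>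
      ((((γ * z⁻¹).1).val : GL (Fin 2) (UnitaryGroup.LocalRing L v)).val - 1) ^ 2 = 0 ∧ (γ * z⁻¹).2 = 1) ∧
      ∀ u : ConjClasses ((UnitaryGroup.cmDatum L 2 (Matrix.of fun i j : Fin 2 => if i.val + j.val + 1 = 2 then (1 : L) else 0)).Local v × (UnitaryGroup.cmDatum L 1 (Matrix.of fun i j : Fin 1 => if i.val + j.val + 1 = 1 then (1 : L) else 0)).Local v),
      (((((Quotient.out u * z⁻¹).1).val : GL (Fin 2) (UnitaryGroup.LocalRing L v)).val - 1) ^ 2 = 0 ∧ (Quotient.out u * z⁻¹).2 = 1) →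
      ∀ fH : (UnitaryGroup.cmDatum L 2 (Matrix.of fun i j : Fin 2 => if i.val + j.val + 1 = 2 then (1 : L) else 0)).Local v × (UnitaryGroup.cmDatum L 1 (Matrix.of fun i j : Fin 1 => if i.val + j.val + 1 = 1 then (1 : L) else 0)).Local v → ℂ, IsLocSmooth fH →
      Integrable (descConj (Quotient.out u : (UnitaryGroup.cmDatum L 2 (Matrix.of fun i j : Fin 2 => if i.val + j.val + 1 = 2 then (1 : L) else 0)).Local v × (UnitaryGroup.cmDatum L 1 (Matrix.of fun i j : Fin 1 => if i.val + j.val + 1 = 1 then (1 : L) else 0)).Local v) (Subgroup.centralizer ({(Quotient.out u : (UnitaryGroup.cmDatum L 2 (Matrix.of fun i j : Fin 2 => if i.val + j.val + 1 = 2 then (1 : L) else 0)).Local v × (UnitaryGroup.cmDatum L 1 (Matrix.of fun i j : Fin 1 => if i.val + j.val + 1 = 1 then (1 : L) else 0)).Local v)} : Set ((UnitaryGroup.cmDatum L 2 (Matrix.of fun i j : Fin 2 => if i.val + j.val + 1 = 2 then (1 : L) else 0)).Local v × (UnitaryGroup.cmDatum L 1 (Matrix.of fun i j : Fin 1 =>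 if i.val + j.val + 1 = 1 then (1 : L) else 0)).Local v)))
      (fun _ hg => Subgroup.mem_centralizer_singleton_iff.1 hg) fH) (mU u))
    (hdual :
      ∀ (L : Type) [Field L] [NumberField L] [IsCMField L] (v : HeightOneSpectrum (𝓞 ↥(maximalRealSubfield L)))
      [MeasurableSpace ((UnitaryGroup.cmDatum L 2 (Matrix.of fun i j : Fin 2 => if i.val + j.val + 1 = 2 then (1 : L) else 0)).Local v × (UnitaryGroup.cmDatum L 1 (Matrix.of fun i j : Fin 1 => if i.val + j.val + 1 = 1 then (1 : L) else 0)).Local v)] [BorelSpace ((UnitaryGroup.cmDatum L 2 (Matrix.of fun i j : Fin 2 => if i.val + j.val + 1 = 2 then (1 : L) else 0)).Local v × (UnitaryGroup.cmDatum L 1 (Matrix.of fun i j : Fin 1 => if i.val + j.val + 1 = 1 then (1 : L) else 0)).Local v)]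
      [∀ a : (UnitaryGroup.cmDatum L 2 (Matrix.of fun i j : Fin 2 => if i.val + j.val + 1 = 2 then (1 : L) else 0)).Local v × (UnitaryGroup.cmDatum L 1 (Matrix.of fun i j : Fin 1 => if i.val + j.val + 1 = 1 then (1 : L) else 0)).Local v,
      MeasurableSpace (((UnitaryGroup.cmDatum L 2 (Matrix.of fun i j : Fin 2 => if i.val + j.val + 1 = 2 then (1 : L) else 0)).Local v × (UnitaryGroup.cmDatum L 1 (Matrix.of fun i j : Fin 1 => if i.val + j.val + 1 = 1 then (1 : L) else 0)).Local v) ⧸ Subgroup.centralizer ({a} : Set ((UnitaryGroup.cmDatum L 2 (Matrix.of fun i j : Fin 2 => if i.val + j.val + 1 = 2 then (1 : L) else 0)).Local v × (UnitaryGroup.cmDatum L 1 (Matrix.of fun i j : Fin 1 => if i.val + j.val + 1 = 1 then (1 : L) else 0)).Local v)))]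
      [∀ a : (UnitaryGroup.cmDatum L 2 (Matrix.of fun i j : Fin 2 => if i.val + j.val + 1 = 2 then (1 : L) else 0)).Local v × (UnitaryGroup.cmDatum L 1 (Matrix.of fun i j : Fin 1 => if i.val + j.val + 1 = 1 then (1 : L) else 0)).Local v,
      BorelSpace (((UnitaryGroup.cmDatum L 2 (Matrix.of fun i j : Fin 2 => if i.val + j.val + 1 = 2 then (1 : L) else 0)).Local v × (UnitaryGroup.cmDatum L 1 (Matrix.of fun i j : Fin 1 => if i.val + j.val + 1 = 1 then (1 : L) else 0)).Local v) ⧸ Subgroup.centralizer ({a} : Set ((UnitaryGroup.cmDatum L 2 (Matrix.of fun i j : Fin 2 => if i.val + j.val + 1 = 2 then (1 : L) else 0)).Local v × (UnitaryGroup.cmDatum L 1 (Matrix.of fun i j : Fin 1 => if i.val + j.val + 1 = 1 then (1 : L) else 0)).Local v)))],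
      Subsingleton (UnitaryGroup.PlacesOver L v) →
      ∀ z : (UnitaryGroup.cmDatum L 2 (Matrix.of fun i j : Fin 2 => if i.val + j.val + 1 = 2 then (1 : L) else 0)).Local v × (UnitaryGroup.cmDatum L 1 (Matrix.of fun i j : Fin 1 => if i.val + j.val + 1 = 1 then (1 : L) else 0)).Local v, z ∈ Subgroup.center ((UnitaryGroup.cmDatum L 2 (Matrix.of fun i j : Fin 2 => if i.val + j.val + 1 = 2 then (1 : L) else 0)).Local v × (UnitaryGroup.cmDatum L 1 (Matrix.of fun i j : Fin 1 => if i.val + j.val + 1 = 1 then (1 : L) else 0)).Local v) →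
      ∀ (S : Finset (ConjClasses ((UnitaryGroup.cmDatum L 2 (Matrix.of fun i j : Fin 2 => if i.val + j.val + 1 = 2 then (1 : L) else 0)).Local v × (UnitaryGroup.cmDatum L 1 (Matrix.of fun i j : Fin 1 => if i.val + j.val + 1 = 1 then (1 : L) else 0)).Local v))) (mU : OrbitalMeasureFamily ((UnitaryGroup.cmDatum L 2 (Matrix.of fun i j : Fin 2 => if i.val + j.val + 1 = 2 then (1 : L) else 0)).Local v × (UnitaryGroup.cmDatum L 1 (Matrix.of fun i j : Fin 1 => if i.val + j.val + 1 = 1 then (1 : L) else 0)).Local v)),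
      (∀ u ∈ S, ((((Quotient.out u * z⁻¹).1).val : GL (Fin 2) (UnitaryGroup.LocalRing L v)).val - 1) ^ 2 = 0 ∧ (Quotient.out u * z⁻¹).2 = 1) →
      mU.IsAdmissibleOn (fun γ : (UnitaryGroup.cmDatum L 2 (Matrix.of fun i j : Fin 2 => if i.val + j.val + 1 = 2 then (1 : L) else 0)).Local v × (UnitaryGroup.cmDatum L 1 (Matrix.of fun i j : Fin 1 => if i.val + j.val + 1 = 1 then (1 : L) else 0)).Local v => ConjClasses.mk γ ∈ S) →
      (∀ u ∈ S, ∀ fH : (UnitaryGroup.cmDatum L 2 (Matrix.of fun i j : Fin 2 => if i.val + j.val + 1 = 2 then (1 : L) else 0)).Local v × (UnitaryGroup.cmDatum L 1 (Matrix.of fun i j : Fin 1 => if i.val + j.val + 1 = 1 then (1 : L) else 0)).Local v → ℂ, IsLocSmooth fH →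
      Integrable (descConj (Quotient.out u : (UnitaryGroup.cmDatum L 2 (Matrix.of fun i j : Fin 2 => if i.val + j.val + 1 = 2 then (1 : L) else 0)).Local v × (UnitaryGroup.cmDatum L 1 (Matrix.of fun i j : Fin 1 => if i.val + j.val + 1 = 1 then (1 : L) else 0)).Local v) (Subgroup.centralizer ({(Quotient.out u : (UnitaryGroup.cmDatum L 2 (Matrix.of fun i j : Fin 2 => if i.val + j.val + 1 = 2 then (1 : L) else 0)).Local v × (UnitaryGroup.cmDatum L 1 (Matrix.of fun i j : Fin 1 => if i.val + j.val + 1 = 1 then (1 : L) else 0)).Local v)} : Set ((UnitaryGroup.cmDatum L 2 (Matrix.of fun i j : Fin 2 => if i.val + j.val + 1 = 2 then (1 : L) else 0)).Local v × (UnitaryGroup.cmDatum L 1 (Matrix.of fun i j : Fin 1 => if i.val + j.val + 1 = 1 then (1 : L) else 0)).Local v)))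
      (fun _ hg => Subgroup.mem_centralizer_singleton_iff.1 hg) fH) (mU u)) →
      ∃ fd : ConjClasses ((UnitaryGroup.cmDatum L 2 (Matrix.of fun i j : Fin 2 => if i.val + j.val + 1 = 2 then (1 : L) else 0)).Local v × (UnitaryGroup.cmDatum L 1 (Matrix.of fun i j : Fin 1 => if i.val + j.val + 1 = 1 then (1 : L) else 0)).Local v) → ((UnitaryGroup.cmDatum L 2 (Matrix.of fun i j : Fin 2 => if i.val + j.val + 1 = 2 then (1 : L) else 0)).Local v × (UnitaryGroup.cmDatum L 1 (Matrix.of fun i j : Fin 1 => if i.val + j.val + 1 = 1 then (1 : L) else 0)).Local v) → ℂ,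
      (∀ u ∈ S, IsLocSmooth (fd u)) ∧ (∀ u ∈ S, classOrbitalIntegral mU (fd u) u = 1) ∧
      (∀ u ∈ S, ∀ u' ∈ S, u ≠ u' → classOrbitalIntegral mU (fd u') u = 0)) :
    ∀ (L : Type) [Field L] [NumberField L] [IsCMField L] (H' : Matrix (Fin 3) (Fin 3) L),
    (H'.map (cmConjRingHom L)).transpose = H' →
    (∀ x : Fin 3 → L, hermForm (cmConjRingHom L) H' x x = 0 → x = 0) →
    ∀ (v : HeightOneSpectrum (𝓞 ↥(maximalRealSubfield L)))
    [MeasurableSpace ((UnitaryGroup.cmDatum L 2 (Matrix.of fun i j : Fin 2 => if i.val + j.val + 1 = 2 then (1 : L) else 0)).Local v × (UnitaryGroup.cmDatum L 1 (Matrix.of fun i j : Fin 1 => if i.val + j.val + 1 = 1 then (1 : L) else 0)).Local v)] [BorelSpace ((UnitaryGroup.cmDatum L 2 (Matrix.of fun i j : Fin 2 => if i.val + j.val + 1 = 2 then (1 : L) else 0)).Local v × (UnitaryGroup.cmDatum L 1 (Matrix.of fun i j : Fin 1 => if i.val + j.val + 1 = 1 then (1 : L) else 0)).Local v)]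
    [∀ a : (UnitaryGroup.cmDatum L 2 (Matrix.of fun i j : Fin 2 => if i.val + j.val + 1 = 2 then (1 : L) else 0)).Local v × (UnitaryGroup.cmDatum L 1 (Matrix.of fun i j : Fin 1 => if i.val + j.val + 1 = 1 then (1 : L) else 0)).Local v,
    MeasurableSpace (((UnitaryGroup.cmDatum L 2 (Matrix.of fun i j : Fin 2 => if i.val + j.val + 1 = 2 then (1 : L) else 0)).Local v × (UnitaryGroup.cmDatum L 1 (Matrix.of fun i j : Fin 1 => if i.val + j.val + 1 = 1 then (1 : L) else 0)).Local v) ⧸ Subgroup.centralizer ({a} : Set ((UnitaryGroup.cmDatum L 2 (Matrix.of fun i j : Fin 2 => if i.val + j.val + 1 = 2 then (1 : L) else 0)).Local v × (UnitaryGroup.cmDatum L 1 (Matrix.of fun i j : Fin 1 => if i.val + j.val + 1 = 1 then (1 : L) else 0)).Local v)))]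
    [∀ a : (UnitaryGroup.cmDatum L 2 (Matrix.of fun i j : Fin 2 => if i.val + j.val + 1 = 2 then (1 : L) else 0)).Local v × (UnitaryGroup.cmDatum L 1 (Matrix.of fun i j : Fin 1 => if i.val + j.val + 1 = 1 then (1 : L) else 0)).Local v,
    BorelSpace (((UnitaryGroup.cmDatum L 2 (Matrix.of fun i j : Fin 2 => if i.val + j.val + 1 = 2 then (1 : L) else 0)).Local v × (UnitaryGroup.cmDatum L 1 (Matrix.of fun i j : Fin 1 => if i.val + j.val + 1 = 1 then (1 : L) else 0)).Local v) ⧸ Subgroup.centralizer ({a} : Set ((UnitaryGroup.cmDatum L 2 (Matrix.of fun i j : Fin 2 => if i.val + j.val + 1 = 2 then (1 : L) else 0)).Local v × (UnitaryGroup.cmDatum L 1 (Matrix.of fun i j : Fin 1 => if i.val + j.val + 1 = 1 then (1 : L) else 0)).Local v)))]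
    [MeasurableSpace ((UnitaryGroup.cmDatum L 3 H').Local v)] [BorelSpace ((UnitaryGroup.cmDatum L 3 H').Local v)]
    [∀ γ : (UnitaryGroup.cmDatum L 3 H').Local v, MeasurableSpace ((UnitaryGroup.cmDatum L 3 H').Local v ⧸ Subgroup.centralizer ({γ} : Set ((UnitaryGroup.cmDatum L 3 H').Local v)))]
    [∀ γ : (UnitaryGroup.cmDatum L 3 H').Local v, BorelSpace ((UnitaryGroup.cmDatum L 3 H').Local v ⧸ Subgroup.centralizer ({γ} : Set ((UnitaryGroup.cmDatum L 3 H').Local v)))]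
    (νHv : Measure ((UnitaryGroup.cmDatum L 2 (Matrix.of fun i j : Fin 2 => if i.val + j.val + 1 = 2 then (1 : L) else 0)).Local v × (UnitaryGroup.cmDatum L 1 (Matrix.of fun i j : Fin 1 => if i.val + j.val + 1 = 1 then (1 : L) else 0)).Local v)) (νGv : Measure ((UnitaryGroup.cmDatum L 3 H').Local v))
    [IsFiniteMeasureOnCompacts νHv] [νHv.IsMulRightInvariant] [νGv.IsHaarMeasure] [νGv.IsMulRightInvariant]
    (Δv : LocalTransferFactor L H' v)
    (mHv : OrbitalMeasureFamily ((UnitaryGroup.cmDatum L 2 (Matrix.of fun i j : Fin 2 => if i.val + j.val + 1 = 2 then (1 : L) else 0)).Local v × (UnitaryGroup.cmDatum L 1 (Matrix.of fun i j : Fin 1 => if i.val + j.val + 1 = 1 then (1 : L) else 0)).Local v)) (mGv : OrbitalMeasureFamily ((UnitaryGroup.cmDatum L 3 H').Local v)),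
    IsLocalTransferDatum L H' v Δv mHv mGv →
    mHv.IsCanonical (IsLocalGRegular L v) νHv →
    mGv.IsCanonical (fun γ : (UnitaryGroup.cmDatum L 3 H').Local v => IsRegularElt (γ.val : GL (Fin 3) (UnitaryGroup.LocalRing L v))) νGv →
    Subsingleton (UnitaryGroup.PlacesOver L v) →
    ∀ z : (UnitaryGroup.cmDatum L 2 (Matrix.of fun i j : Fin 2 => if i.val + j.val + 1 = 2 then (1 : L) else 0)).Local v × (UnitaryGroup.cmDatum L 1 (Matrix.of fun i j : Fin 1 => if i.val + j.val + 1 = 1 then (1 : L) else 0)).Local v, z ∈ Subgroup.center ((UnitaryGroup.cmDatum L 2 (Matrix.of fun i j : Fin 2 => if i.val + j.val + 1 = 2 then (1 : L) else 0)).Local v × (UnitaryGroup.cmDatum L 1 (Matrix.of fun i j : Fin 1 => if i.val + j.val + 1 = 1 then (1 : L) else 0)).Local v) →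
    ∃ (S : Finset (ConjClasses ((UnitaryGroup.cmDatum L 2 (Matrix.of fun i j : Fin 2 => if i.val + j.val + 1 = 2 then (1 : L) else 0)).Local v × (UnitaryGroup.cmDatum L 1 (Matrix.of fun i j : Fin 1 => if i.val + j.val + 1 = 1 then (1 : L) else 0)).Local v))) (mU : OrbitalMeasureFamily ((UnitaryGroup.cmDatum L 2 (Matrix.of fun i j : Fin 2 => if i.val + j.val + 1 = 2 then (1 : L) else 0)).Local v × (UnitaryGroup.cmDatum L 1 (Matrix.of fun i j : Fin 1 => if i.val + j.val + 1 = 1 then (1 : L) else 0)).Local v))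
    (Γ : ConjClasses ((UnitaryGroup.cmDatum L 2 (Matrix.of fun i j : Fin 2 => if i.val + j.val + 1 = 2 then (1 : L) else 0)).Local v × (UnitaryGroup.cmDatum L 1 (Matrix.of fun i j : Fin 1 => if i.val + j.val + 1 = 1 then (1 : L) else 0)).Local v) → (UnitaryGroup.cmDatum L 2 (Matrix.of fun i j : Fin 2 => if i.val + j.val + 1 = 2 then (1 : L) else 0)).Local v × (UnitaryGroup.cmDatum L 1 (Matrix.of fun i j : Fin 1 => if i.val + j.val + 1 = 1 then (1 : L) else 0)).Local v → ℂ),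
    ConjClasses.mk z ∈ S ∧
    (∀ u ∈ S, ((((Quotient.out u * z⁻¹).1).val : GL (Fin 2) (UnitaryGroup.LocalRing L v)).val - 1) ^ 2 = 0 ∧ (Quotient.out u * z⁻¹).2 = 1) ∧
    mU.IsAdmissibleOn (fun γ : (UnitaryGroup.cmDatum L 2 (Matrix.of fun i j : Fin 2 => if i.val + j.val + 1 = 2 then (1 : L) else 0)).Local v × (UnitaryGroup.cmDatum L 1 (Matrix.of fun i j : Fin 1 => if i.val + j.val + 1 = 1 then (1 : L) else 0)).Local v => ConjClasses.mk γ ∈ S) ∧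
    (∀ u ∈ S, ∀ fH : (UnitaryGroup.cmDatum L 2 (Matrix.of fun i j : Fin 2 => if i.val + j.val + 1 = 2 then (1 : L) else 0)).Local v × (UnitaryGroup.cmDatum L 1 (Matrix.of fun i j : Fin 1 => if i.val + j.val + 1 = 1 then (1 : L) else 0)).Local v → ℂ, IsLocSmooth fH →
    Integrable (descConj (Quotient.out u : (UnitaryGroup.cmDatum L 2 (Matrix.of fun i j : Fin 2 => if i.val + j.val + 1 = 2 then (1 : L) else 0)).Local v × (UnitaryGroup.cmDatum L 1 (Matrix.of fun i j : Fin 1 => if i.val + j.val + 1 = 1 then (1 : L) else 0)).Local v) (Subgroup.centralizer ({(Quotient.out u : (UnitaryGroup.cmDatum L 2 (Matrix.of fun i j : Fin 2 => if i.val + j.val + 1 = 2 then (1 : L) else 0)).Local v × (UnitaryGroup.cmDatum L 1 (Matrix.of fun i j : Fin 1 => if i.val + j.val + 1 = 1 then (1 : L) else 0)).Local v)} : Set ((UnitaryGroup.cmDatum L 2 (Matrix.of fun i j : Fin 2 => if i.val + j.val + 1 = 2 then (1 : L) else 0)).Local v × (UnitaryGroup.cmDatum L 1 (Matrix.of fun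 i j : Fin 1 => if i.val + j.val + 1 = 1 then (1 : L) else 0)).Local v)))
    (fun _ hg => Subgroup.mem_centralizer_singleton_iff.1 hg) fH) (mU u)) ∧
    (∀ fH : (UnitaryGroup.cmDatum L 2 (Matrix.of fun i j : Fin 2 => if i.val + j.val + 1 = 2 then (1 : L) else 0)).Local v × (UnitaryGroup.cmDatum L 1 (Matrix.of fun i j : Fin 1 => if i.val + j.val + 1 = 1 then (1 : L) else 0)).Local v → ℂ, IsLocSmooth fH → ∀ᶠ γ in 𝓝[{γ : (UnitaryGroup.cmDatum L 2 (Matrix.of fun i j : Fin 2 => if i.val + j.val + 1 = 2 then (1 : L) else 0)).Local v × (UnitaryGroup.cmDatum L 1 (Matrix.of fun i j : Fin 1 => if i.val + j.val + 1 = 1 then (1 : L) else 0)).Local v |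
    IsLocalGRegular L v γ ∧ CompactSpace (Subgroup.centralizer ({γ} : Set ((UnitaryGroup.cmDatum L 2 (Matrix.of fun i j : Fin 2 => if i.val + j.val + 1 = 2 then (1 : L) else 0)).Local v × (UnitaryGroup.cmDatum L 1 (Matrix.of fun i j : Fin 1 => if i.val + j.val + 1 = 1 then (1 : L) else 0)).Local v)))}] z,
    stableOrbitalIntegralRel (IsLocalStablyConjH L v) mHv fH γ = ∑ u ∈ S, classOrbitalIntegral mU fH u * Γ u γ) := by
  intro L _ _ _ H' _ _ v _ _ _ _ _ _ _ _ νHv νGv _ _ _ _ Δv mHv mGv _ hcanH _ hsub z hz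
  classical
  haveI : Algebra.IsQuadraticExtension ↥(maximalRealSubfield L) L := IsCMField.isQuadraticExtension L
  obtain ⟨w⟩ := UnitaryGroup.PlacesOver.nonempty L v
  -- abbreviations for the carrier-wide facts
  have hout : ∀ c : ConjClasses ((UnitaryGroup.cmDatum L 2 (Matrix.of fun i j : Fin 2 => if i.val + j.val + 1 = 2 then (1 : L) else 0)).Local v × (UnitaryGroup.cmDatum L 1 (Matrix.of fun i j : Fin 1 => if i.val + j.val + 1 = 1 then (1 : L) else 0)).Local v), ConjClasses.mk (Quotient.out c) = c := fun c => Quotient.out_eq c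
  -- ## S := the classes over `z` (★ (E1))
  obtain ⟨S, hS⟩ := unitaryTwoOne_central_unipotent_conjClasses_finite L v w hsub z hz
  have hunip : ∀ u ∈ S, ((((Quotient.out u * z⁻¹).1).val : GL (Fin 2) (UnitaryGroup.LocalRing L v)).val - 1) ^ 2 = 0 ∧ (Quotient.out u * z⁻¹).2 = 1 :=
    fun u hu => (hS u).1 hu
  have hPconj := fun (γ x : (UnitaryGroup.cmDatum L 2 (Matrix.of fun i j : Fin 2 => if i.val + j.val + 1 = 2 then (1 : L) else 0)).Local v × (UnitaryGroup.cmDatum L 1 (Matrix.of fun i j : Fin 1 => if i.val + j.val + 1 = 1 then (1 : L) else 0)).Local v) => centralUnipotent_conj_iff (L := L) (v := v) hz γ x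
  have hPz := centralUnipotent_self L v z
  have hzc : ∀ g : (UnitaryGroup.cmDatum L 2 (Matrix.of fun i j : Fin 2 => if i.val + j.val + 1 = 2 then (1 : L) else 0)).Local v × (UnitaryGroup.cmDatum L 1 (Matrix.of fun i j : Fin 1 => if i.val + j.val + 1 = 1 then (1 : L) else 0)).Local v, g * z = z * g := fun g => Subgroup.mem_center_iff.1 hz g
  have hzS : ConjClasses.mk z ∈ S := by
    refine (hS _).2 ?_
    rw [quotientOut_conjClassesMk_eq_of_forall_comm hzc]
    exact hPz
  -- ## mU := (RAO_z); dual pieces := (DUAL_z)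
  obtain ⟨mU, hadm, hraoU⟩ := hrao L v hsub z hz
  have hadmS : mU.IsAdmissibleOn (fun γ : (UnitaryGroup.cmDatum L 2 (Matrix.of fun i j : Fin 2 => if i.val + j.val + 1 = 2 then (1 : L) else 0)).Local v × (UnitaryGroup.cmDatum L 1 (Matrix.of fun i j : Fin 1 => if i.val + j.val + 1 = 1 then (1 : L) else 0)).Local v => ConjClasses.mk γ ∈ S) := by
    intro c hc
    have hc' : c ∈ S := by rwa [hout c] at hc
    exact hadm c ((hS c).1 hc')
  have hraoS : ∀ u ∈ S, ∀ fH : (UnitaryGroup.cmDatum L 2 (Matrix.of fun i j : Fin 2 => if i.val + j.val + 1 = 2 then (1 : L) else 0)).Local v × (UnitaryGroup.cmDatum L 1 (Matrix.of fun i j : Fin 1 => if i.val + j.val + 1 = 1 then (1 : L) else 0)).Local v → ℂ, IsLocSmooth fH →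
      Integrable (descConj (Quotient.out u : (UnitaryGroup.cmDatum L 2 (Matrix.of fun i j : Fin 2 => if i.val + j.val + 1 = 2 then (1 : L) else 0)).Local v × (UnitaryGroup.cmDatum L 1 (Matrix.of fun i j : Fin 1 => if i.val + j.val + 1 = 1 then (1 : L) else 0)).Local v) (Subgroup.centralizer ({(Quotient.out u : (UnitaryGroup.cmDatum L 2 (Matrix.of fun i j : Fin 2 => if i.val + j.val + 1 = 2 then (1 : L) else 0)).Local v × (UnitaryGroup.cmDatum L 1 (Matrix.of fun i j : Fin 1 => if i.val + j.val + 1 = 1 then (1 : L) else 0)).Local v)} : Set ((UnitaryGroup.cmDatum L 2 (Matrix.of fun i j : Fin 2 => if i.val + j.val + 1 = 2 then (1 : L) else 0)).Local v × (UnitaryGroup.cmDatum L 1 (Matrix.of fun i j : Fin 1 => if i.val + j.val + 1 = 1 then (1 : L) else 0)).Local v)))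
        (fun _ hg => Subgroup.mem_centralizer_singleton_iff.1 hg) fH) (mU u) :=
    fun u hu => hraoU u (hunip u hu)
  obtain ⟨fd, hfd, hdual1, hdual0⟩ := hdual L v hsub z hz S mU hunip hadmS hraoS
  -- ## SPAN (Howe) over the closed enumeration of the classes over `z`
  haveI : TotallyDisconnectedSpace ((UnitaryGroup.cmDatum L 2 (Matrix.of fun i j : Fin 2 => if i.val + j.val + 1 = 2 then (1 : L) else 0)).Local v) :=
    totallyDisconnectedSpace_cmDatum_local (L := L) (N := 2) (H := (Matrix.of fun i j : Fin 2 => if i.val + j.val + 1 = 2 then (1 : L) else 0)) (v := v)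
  haveI : TotallyDisconnectedSpace ((UnitaryGroup.cmDatum L 1 (Matrix.of fun i j : Fin 1 => if i.val + j.val + 1 = 1 then (1 : L) else 0)).Local v) :=
    totallyDisconnectedSpace_cmDatum_local (L := L) (N := 1) (H := (Matrix.of fun i j : Fin 1 => if i.val + j.val + 1 = 1 then (1 : L) else 0)) (v := v)
  have hspan := exists_add_mem_span_conj_sub_of_classOrbitalIntegral_eq_zero
    (fun γ : (UnitaryGroup.cmDatum L 2 (Matrix.of fun i j : Fin 2 => if i.val + j.val + 1 = 2 then (1 : L) else 0)).Local v × (UnitaryGroup.cmDatum L 1 (Matrix.of fun i j : Fin 1 => if i.val + j.val + 1 = 1 then (1 : L) else 0)).Local v => ((((γ * z⁻¹).1).val : GL (Fin 2) (UnitaryGroup.LocalRing L v)).val - 1) ^ 2 = 0 ∧ (γ * z⁻¹).2 = 1) S hS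
    (fun g x => hPconj g x) (exists_enum_centralUnipotent_isClosed_iUnion_lt L v w hsub hz S hS) mU hadmS hraoS
  -- ## the germs: stable H-integrals of the dual pieces
  refine ⟨S, mU, fun u γ => stableOrbitalIntegralRel (IsLocalStablyConjH L v) mHv (fd u) γ, hzS, hunip, hadmS, hraoS, ?_⟩
  intro fH hfH
  -- `C_c^∞` is stable under the scalings used below
  have hsm : ∀ (c : ℂ) {ψ : (UnitaryGroup.cmDatum L 2 (Matrix.of fun i j : Fin 2 => if i.val + j.val + 1 = 2 then (1 : L) else 0)).Local v × (UnitaryGroup.cmDatum L 1 (Matrix.of fun i j : Fin 1 => if i.val + j.val + 1 = 1 then (1 : L) else 0)).Local v → ℂ}, IsLocSmooth ψ → IsLocSmooth (c • ψ) := fun c ψ hψ =>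
    ⟨hψ.1.comp fun t => c * t, hψ.2.mono (Function.support_const_smul_subset c ψ)⟩
  -- Step 1: the correction `P := Σ_u Φ_U(u, fH) • fd u`, `F := fH − P`, `Φ_U(u′, F) = 0` on `S`
  set P : (UnitaryGroup.cmDatum L 2 (Matrix.of fun i j : Fin 2 => if i.val + j.val + 1 = 2 then (1 : L) else 0)).Local v × (UnitaryGroup.cmDatum L 1 (Matrix.of fun i j : Fin 1 => if i.val + j.val + 1 = 1 then (1 : L) else 0)).Local v → ℂ := ∑ u ∈ S, classOrbitalIntegral mU fH u • fd u with hP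
  have hPs : IsLocSmooth P := IsLocSmooth.finset_sum S fun u hu => hsm _ (hfd u hu)
  set F : (UnitaryGroup.cmDatum L 2 (Matrix.of fun i j : Fin 2 => if i.val + j.val + 1 = 2 then (1 : L) else 0)).Local v × (UnitaryGroup.cmDatum L 1 (Matrix.of fun i j : Fin 1 => if i.val + j.val + 1 = 1 then (1 : L) else 0)).Local v → ℂ := fH - P with hF
  have hFs : IsLocSmooth F := ⟨hfH.1.sub hPs.1, hfH.2.sub hPs.2⟩
  have hPexp : ∀ u' ∈ S, classOrbitalIntegral mU P u' = ∑ u ∈ S, classOrbitalIntegral mU fH u * classOrbitalIntegral mU (fd u) u' := by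
    intro u' hu'
    rw [hP, classOrbitalIntegral_finset_sum mU S (fun u => classOrbitalIntegral mU fH u • fd u) u' (fun u hu => hraoS u' hu' _ (hsm _ (hfd u hu)))]
    refine Finset.sum_congr rfl fun u _ => ?_
    simp only [classOrbitalIntegral_eq, orbitalIntegral_smul, smul_eq_mul]
  have hFU : ∀ u' ∈ S, classOrbitalIntegral mU F u' = 0 := by
    intro u' hu'
    have hI := hraoS u' hu'
    rw [hF, classOrbitalIntegral_eq, orbitalIntegral_sub _ _ (hI fH hfH) (hI P hPs), ← classOrbitalIntegral_eq, ← classOrbitalIntegral_eq,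
      hPexp u' hu', sub_eq_zero]
    rw [Finset.sum_eq_single_of_mem u' hu' fun u hu hne => by rw [hdual0 u' hu' u hu (Ne.symm hne), mul_zero], hdual1 u' hu', mul_one]
  -- Step 2: Howe's span decomposition of `F`
  obtain ⟨F₀, F₁, hFeq, hF₀, hF₁far⟩ := hspan F hFs hFU
  have hF₀s : IsLocSmooth F₀ := isLocSmooth_of_mem_span_conj_sub hF₀
  have hF₁eq : F₁ = F - F₀ := by rw [hFeq, add_sub_cancel_left]
  have hF₁s : IsLocSmooth F₁ := by rw [hF₁eq]; exact ⟨hFs.1.sub hF₀s.1, hFs.2.sub hF₀s.2⟩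
  -- Step 3: FAR_z — a neighbourhood of `z` on which `F₁` has identically vanishing orbital integrands over whole stable classes
  obtain ⟨U, hU, hfarU⟩ := exists_nhds_forall_isLocalStablyConjH_conj_apply_eq_zero L v w hsub hz F₁ hF₁s.2 hF₁far
  have hUw : U ∈ 𝓝[{γ : (UnitaryGroup.cmDatum L 2 (Matrix.of fun i j : Fin 2 => if i.val + j.val + 1 = 2 then (1 : L) else 0)).Local v × (UnitaryGroup.cmDatum L 1 (Matrix.of fun i j : Fin 1 => if i.val + j.val + 1 = 1 then (1 : L) else 0)).Local v | IsLocalGRegular L v γ ∧ CompactSpace (Subgroup.centralizer ({γ} : Set ((UnitaryGroup.cmDatum L 2 (Matrix.of fun i j : Fin 2 => if i.val + j.val + 1 = 2 then (1 : L) else 0)).Local v × (UnitaryGroup.cmDatum L 1 (Matrix.of fun i j : Fin 1 => if i.val + j.val + 1 = 1 then (1 : L) else 0)).Local v)))}] z :=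
    mem_nhdsWithin_of_mem_nhds hU
  filter_upwards [hUw, self_mem_nhdsWithin] with γ hγU hγreg
  obtain ⟨hreg, -⟩ := hγreg
  -- Step 4: the degenerate frame `νHv = 0`
  by_cases hν : νHv = 0
  · rw [stableOrbitalIntegralRel_eq_zero_of_measure_eq_zero L v νHv mHv hcanH hν fH hreg]
    symm
    refine Finset.sum_eq_zero fun u _ => ?_
    rw [stableOrbitalIntegralRel_eq_zero_of_measure_eq_zero L v νHv mHv hcanH hν (fd u) hreg, mul_zero]
  -- Step 5: `νHv` is a Haar measure; the canonical `mHv` is admissible on the `G`-regular classes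
  haveI : νHv.IsHaarMeasure := isHaarMeasure_of_ne_zero L v νHv hν
  have hadmH : mHv.IsAdmissibleOn (IsLocalGRegular L v) := hcanH.isAdmissibleOn
  -- `fH = P + (F₀ + F₁)` and stable additivity at the `G`-regular `γ`
  have hfHeq : fH = P + (F₀ + F₁) := by rw [← hFeq, hF, add_sub_cancel]
  have hF01s : IsLocSmooth (F₀ + F₁) := hF₀s.add hF₁s
  have hLHS : stableOrbitalIntegralRel (IsLocalStablyConjH L v) mHv fH γ =
      stableOrbitalIntegralRel (IsLocalStablyConjH L v) mHv P γ +
        (stableOrbitalIntegralRel (IsLocalStablyConjH L v) mHv F₀ γ + stableOrbitalIntegralRel (IsLocalStablyConjH L v) mHv F₁ γ) := by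
    conv_lhs => rw [hfHeq]
    rw [UnitaryGroup.localStableOrbitalIntegralH_add_of_isLocalGRegular L v γ hreg (hm := hadmH) hPs.1.continuous hPs.2 hF01s.1.continuous hF01s.2,
      UnitaryGroup.localStableOrbitalIntegralH_add_of_isLocalGRegular L v γ hreg (hm := hadmH) hF₀s.1.continuous hF₀s.2 hF₁s.1.continuous hF₁s.2]
  -- Step 6: `Φ^{st}(γ, F₀) = 0` — `C₀` is killed at every `G`-regular class
  have hF₀0 : stableOrbitalIntegralRel (IsLocalStablyConjH L v) mHv F₀ γ = 0 := by
    rw [stableOrbitalIntegralRel_def]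
    refine finsum_mem_of_eqOn_zero fun c hc => ?_
    have hreg' : IsLocalGRegular L v (Quotient.out c) := isGRegular_of_isStablyConjH _ _ _ _ hc hreg
    haveI : IsFiniteMeasureOnCompacts (mHv c) := (hadmH c hreg').2.2
    exact classOrbitalIntegral_eq_zero_of_mem_span_conj_sub hadmH hreg'
      (fun φ hφ => UnitaryGroup.integrable_descConj_localH_of_isLocalGRegular L v (Quotient.out c) hreg' hφ.1.continuous hφ.2 (mHv c)) hF₀
  -- Step 7: `Φ^{st}(γ, F₁) = 0` — the far part has vanishing integrands over every class of the stable class of `γ ∈ U`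
  have hF₁0 : stableOrbitalIntegralRel (IsLocalStablyConjH L v) mHv F₁ γ = 0 := by
    rw [stableOrbitalIntegralRel_def]
    refine finsum_mem_of_eqOn_zero fun c hc => ?_
    have hzero : descConj (Quotient.out c : (UnitaryGroup.cmDatum L 2 (Matrix.of fun i j : Fin 2 => if i.val + j.val + 1 = 2 then (1 : L) else 0)).Local v × (UnitaryGroup.cmDatum L 1 (Matrix.of fun i j : Fin 1 => if i.val + j.val + 1 = 1 then (1 : L) else 0)).Local v) (Subgroup.centralizer ({(Quotient.out c : (UnitaryGroup.cmDatum L 2 (Matrix.of fun i j : Fin 2 => if i.val + j.val + 1 = 2 then (1 : L) else 0)).Local v × (UnitaryGroup.cmDatum L 1 (Matrix.of fun i j : Fin 1 => if i.val + j.val + 1 = 1 then (1 : L) else 0)).Local v)} : Set ((UnitaryGroup.cmDatum L 2 (Matrix.of fun i j : Fin 2 => if i.val + j.val + 1 = 2 then (1 : L) else 0)).Local v × (UnitaryGroup.cmDatum L 1 (Matrix.of fun i j : Fin 1 => if i.val + j.val + 1 = 1 then (1 : L) else 0)).Local v)))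
        (fun _ hg => Subgroup.mem_centralizer_singleton_iff.1 hg) F₁ = fun _ => 0 := by
      funext y
      induction y using QuotientGroup.induction_on with
      | H x => rw [descConj_mk]; exact hfarU γ hγU (Quotient.out c) hc x
    show orbitalIntegral (Quotient.out c) F₁ (mHv c) = 0
    rw [orbitalIntegral_eq_integral_descConj, hzero, integral_zero]
  -- Step 8: `Φ^{st}(γ, P) = Σ_u Φ_U(u, fH)·Γ_u(γ)`
  rw [hLHS, hF₀0, hF₁0, add_zero, add_zero, hP]
  exact stableOrbitalIntegralRel_finset_sum_smul_of_isLocalGRegular L v hadmH hreg S (fun u => classOrbitalIntegral mU fH u) fd hfd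

end Summit.HodgeConjecture.HodgeConjecture.Cruxes.H413.K2E3CentralGermExpansionExistenceOfRao

end
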